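import Summits.ResolutionOfSingularities.ResolutionOfSingularities.Theorems.MarkedTransferCampaignW46ThreefoldsGammaFreeGlobalCurves
import Literature.AlgebraicGeometry.Resolution.BlowupSNC
import Literature.AlgebraicGeometry.Resolution.MarkedResolutions
import Literature.AlgebraicGeometry.Hironaka2017.Proofs.S16Proof.GammaSelect
import HarnessLib

/-!
# [OURS · L1 W4.6 rung (ii-1⁺)] THE HOST ITEM ON CURVES: a MARKED RESOLUTION (BGMW Def. 3.1.3, WITH the snc boundary) of
# every marked ideal `(I, E, m)` on a regular integral curve — the `d ≤ 1` slice of the LITERAL conclusion of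
# MarkedTransfer `HypersurfaceOrderReductionDimLeThree` (stmt-16156), proved (def-free, route-independent)

Cell res-hironaka, LADDER-RESOLUTION rung L (D-0089), slot W4.6, rung (ii); res-L1-type-o1 RUNG MAP v1.1 NEXT (ii) OBJECT (ii-1⁺)
«the d ≤ 1 slice of the HOST item's literal conclusion (marked resolution WITH snc boundary, `IsMarkedResolution`)»; seat
res-L1-s46-pv-10 = res-D-pv-047 (TAKING 2026-08-27T05:1xZ). Host route MarkedTransfer, host item
`HypersurfaceOrderReductionDimLeThree` (stmt-ResolutionOfSingularities-16156), `--kind proof --supports … --as helper`. This module is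
ROUTE-INDEPENDENT (no `Theses/…` import): it proves the universe-polymorphic, def-free theorem; the one-line closer against the OURS
Prop the typer files in a Theses-importing leaf is a separate file. Everything is OURS; nothing is a statement of the manuscript; no
typed `Hironaka2017` candidate and no `Literature.…` named FACT enters. AI-written; weaker than expert review.

## What is proved

* `CampaignW46.hasSNCWith_of_stalkIdeal_eq_maximalIdeal` — a centre whose stalk at each of its points is the whole maximal ideal has
  simple normal crossings with every snc boundary (it is spanned by ALL of any regular system of parameters); the reduced closed
  point `{x}` is the tree's `Hironaka2017.S16Proof.hasSNCWith_singleton_of_hasSNC` (cited, not re-derived).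
* `CampaignW46.marked_step_at_point` / `marked_reduce_at_point` — the identity-step mechanism of `…GammaFreeGlobalCurves.lean`
  (p497830: `𝟙 X` is the blow-up along the Cartier closed point `{x}` of a curve, the controlled transform divides by `𝓘_{x}^m`)
  THREADED THROUGH BGMW's marked transforms: one `IsMultipleBlowup.single` step with centre `𝓘_{x}` (regular, inside the support,
  snc with the boundary), the new boundary `E.map (strictTransform) ++ [𝓘_{x}]` again snc (tree `MarkedIdeal.hasSNC_transform_boundary`,
  Kollár Def. 3.25), `ord_x` dropping by `m`; iterated at `x` until `ord_x < m`.
* `CampaignW46.exists_isMarkedResolution_of_dim_le_one` — **for an integral Noetherian regular scheme `X` of dimension `≤ 1`, every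
  marked ideal `(I, E, m)` with `I ≠ 0`, `E` snc and `m ≥ 1` has a marked resolution** `IsMarkedResolution ⟨I, E, m⟩ (𝟙 X) M′`
  (induction on the number of points of order `≥ m`, `IsMultipleBlowup.trans`).
* `CampaignW46.hypersurfaceOrderReduction_of_dim_le_one` — the same in the binders of the host item (any field `k`, `X → Spec k`
  locally of finite type and quasi-compact, `X` integral regular of `topologicalKrullDim ≤ 1`, `I ≠ ⊥`, `E` snc, `1 ≤ m`; the perfectness,
  separatedness and Cartier binders of 16156 are not needed): `∃ X′ Φ M′, IsMarkedResolution ⟨I, E, m⟩ Φ M′`. This IS the `d ≤ 1` slice of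
  stmt-16156's literal conclusion — a partial result on the host item itself (its `d ≤ 3` statement is the calibration
  [CossartJannsenSaito2020] and stays open in the tree).

References: `…GammaFreeGlobalCurves.lean` (p497830), tree `Resolution/MarkedIdeals.lean` (`MarkedIdeal`, `IsMultipleBlowup`,
`IsMarkedResolution`, `HasSNCWith` [BierstoneGrigorievMilmanWlodarczyk2011 Def. 3.1.1–3.1.4]), `Resolution/BlowupSNC.lean`
(`MarkedIdeal.hasSNC_transform_boundary` [Kollar2007 Def. 3.25]), `Resolution/MarkedResolutions.lean` (`IsMultipleBlowup.trans`).
H. Hironaka, ms. 2017-03-23 — not used. [Hironaka2017]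
-/

noncomputable section

set_option linter.dupNamespace false -- mandated namespace of this single-conjunct summit

open CategoryTheory AlgebraicGeometry TopologicalSpace IsLocalRing

namespace Summit.ResolutionOfSingularities.ResolutionOfSingularities.Theorems

namespace CampaignW46

open Literature.AlgebraicGeometry.Resolution
open Scheme.IdealSheafData

universe u

/-! ## §1 Reduced points have simple normal crossings with every snc boundary -/

section SNC

variable {X : Scheme.{u}}

/-- A centre `C` whose stalk at each point of its support is the whole maximal ideal has simple normal crossings with every snc
boundary `E`: at such a point `C_x = (u_1, …, u_d)` for ANY regular system of parameters `u` adapted to `E`.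
[cite: BierstoneGrigorievMilmanWlodarczyk2011, Def. 3.1.3 (2)] -/
theorem hasSNCWith_of_stalkIdeal_eq_maximalIdeal {E : List X.IdealSheafData} (hE : HasSNC E) {C : X.IdealSheafData}
    (hC : ∀ x ∈ C.support, stalkIdeal C x = maximalIdeal (X.presheaf.stalk x)) : HasSNCWith E C := by
  intro x
  obtain ⟨hreg, u, hu, hι, -⟩ := hE x
  refine ⟨hreg, u, hu, hι, fun hx => ⟨Set.univ, ?_⟩⟩
  rw [hC x hx, Set.image_univ, hu]

end SNC

/-! ## §2 The identity step at a point, threaded through the marked transform -/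

section PointStep

variable {X : Scheme.{u}} [IsIntegral X] [IsLocallyNoetherian X]

/-- **ONE MARKED STEP AT A POINT OF ORDER `v ≥ μ`.** `x` a closed point with `𝒪_{X,x}` a DVR, `M = (I, E, μ)` a marked ideal with
`E` snc and `I_x = 𝔪_x^v`, `μ ≤ v`. Then the identity `𝟙 X` (the blow-up along the Cartier centre `𝓘_{x}`) is an admissible BGMW
step: `IsMultipleBlowup M (𝟙 X) M₁` for `M₁ := M.transform (𝟙 X) 𝓘_{x}`, whose boundary is again snc, whose ideal has stalk
`𝔪_x^{v−μ}` at `x` and the stalks of `I` elsewhere, and contains `I`. [cite: BierstoneGrigorievMilmanWlodarczyk2011, Def. 3.1.3] -/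
theorem marked_step_at_point {x : X} (hx : IsClosed ({x} : Set X)) [IsDiscreteValuationRing (X.presheaf.stalk x)]
    (M : MarkedIdeal X) {v : ℕ} (hv : stalkIdeal M.ideal x = maximalIdeal (X.presheaf.stalk x) ^ v) (hmv : M.mult ≤ v)
    (hE : HasSNC M.boundary) :
    IsMultipleBlowup M (𝟙 X) (M.transform (𝟙 X) (vanishingIdeal (⟨{x}, hx⟩ : Closeds X))) ∧
      HasSNC (M.transform (𝟙 X) (vanishingIdeal (⟨{x}, hx⟩ : Closeds X))).boundary ∧
      stalkIdeal (M.transform (𝟙 X) (vanishingIdeal (⟨{x}, hx⟩ : Closeds X))).ideal x =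
        maximalIdeal (X.presheaf.stalk x) ^ (v - M.mult) ∧
      (∀ y : X, y ≠ x → stalkIdeal (M.transform (𝟙 X) (vanishingIdeal (⟨{x}, hx⟩ : Closeds X))).ideal y = stalkIdeal M.ideal y) ∧
      M.ideal ≤ (M.transform (𝟙 X) (vanishingIdeal (⟨{x}, hx⟩ : Closeds X))).ideal := by
  set C : X.IdealSheafData := vanishingIdeal (⟨{x}, hx⟩ : Closeds X) with hC
  have hcart : IsEffectiveCartier C := isEffectiveCartier_vanishingIdeal_singleton_of_dvr hx
  have hπ : IsBlowup (𝟙 X) C := IsBlowup.id hcart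
  have hsupp : (C.support : Set X) ⊆ M.support := by
    intro y hy
    rw [hC, Scheme.IdealSheafData.coe_support_vanishingIdeal] at hy
    have hyx : y = x := hy
    subst hyx
    rw [MarkedIdeal.mem_support_iff, hv]
    exact Ideal.pow_le_pow_right hmv
  have hsnc : HasSNCWith M.boundary C := Literature.AlgebraicGeometry.Hironaka2017.S16Proof.hasSNCWith_singleton_of_hasSNC hE hx
  obtain ⟨-, hx₁, hy₁, hle₁⟩ := step_at_point hx hv hmv (I := M.ideal)
  refine ⟨IsMultipleBlowup.single M C (𝟙 X) hπ (isRegular_subscheme_vanishingIdeal_singleton hx) hsupp hsnc,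
    M.hasSNC_transform_boundary hsnc hπ, ?_, ?_, ?_⟩
  · rw [MarkedIdeal.transform_ideal]; exact hx₁
  · intro y hy; rw [MarkedIdeal.transform_ideal]; exact hy₁ y hy
  · rw [MarkedIdeal.transform_ideal]; exact hle₁

/-- **MARKED ORDER REDUCTION AT ONE POINT**: with `x`, `X` as above and `μ ≥ 1`, finitely many identity steps at `x` turn `M` with
`I_x = 𝔪_x^v` into a multiple blow-up `IsMultipleBlowup M (𝟙 X) M₁` with snc boundary, the same multiplicity, `ord_x(M₁.ideal) < μ`, the
stalks elsewhere unchanged and `M.ideal ⊆ M₁.ideal`. Induction on `v`. [cite: BierstoneGrigorievMilmanWlodarczyk2011, Def. 3.1.3] -/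
theorem marked_reduce_at_point {x : X} (hx : IsClosed ({x} : Set X)) [IsDiscreteValuationRing (X.presheaf.stalk x)]
    {μ : ℕ} (hμ : 1 ≤ μ) :
    ∀ (v : ℕ) (M : MarkedIdeal X), M.mult = μ → stalkIdeal M.ideal x = maximalIdeal (X.presheaf.stalk x) ^ v →
      HasSNC M.boundary →
      ∃ M₁ : MarkedIdeal X, IsMultipleBlowup M (𝟙 X) M₁ ∧ HasSNC M₁.boundary ∧ M₁.mult = μ ∧
        idealOrder M₁.ideal x < μ ∧ (∀ y : X, y ≠ x → stalkIdeal M₁.ideal y = stalkIdeal M.ideal y) ∧ M.ideal ≤ M₁.ideal := by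
  intro v
  induction v using Nat.strong_induction_on with
  | _ v ih =>
    intro M hMμ hv hE
    by_cases hlt : v < μ
    · refine ⟨M, IsMultipleBlowup.refl M, hE, hMμ, ?_, fun _ _ => rfl, le_rfl⟩
      rw [idealOrder_eq_of_stalkIdeal_eq_pow hv]
      exact_mod_cast hlt
    · have hmv : M.mult ≤ v := by rw [hMμ]; exact not_lt.mp hlt
      obtain ⟨hseq₁, hE₁, hx₁, hy₁, hle₁⟩ := marked_step_at_point hx M hv hmv hE
      have hmult₁ : (M.transform (𝟙 X) (vanishingIdeal (⟨{x}, hx⟩ : Closeds X))).mult = μ := by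
        rw [MarkedIdeal.transform_mult, hMμ]
      rw [hMμ] at hx₁
      obtain ⟨M₁, hseq, hE', hmult, hord, hy, hle⟩ := ih (v - μ) (by omega) _ hmult₁ hx₁ hE₁
      refine ⟨M₁, ?_, hE', hmult, hord, fun y hyx => (hy y hyx).trans (hy₁ y hyx), hle₁.trans hle⟩
      have h := hseq₁.trans hseq
      rwa [Category.comp_id] at h

end PointStep

/-! ## §3 Marked resolutions on a regular integral Noetherian curve -/

section Curve

variable {X : Scheme.{u}} [IsIntegral X] [IsLocallyNoetherian X] [CompactSpace X]

/-- **EVERY MARKED IDEAL ON A REGULAR CURVE HAS A MARKED RESOLUTION** (no base field): `X` integral Noetherian regular of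
`topologicalKrullDim ≤ 1`, `I ≠ 0`, `E` snc, `m ≥ 1` ⇒ `∃ M′, IsMarkedResolution ⟨I, E, m⟩ (𝟙 X) M′` — by identity steps at the finitely
many closed points of order `≥ m`, each an admissible BGMW blow-up (regular Cartier centre inside the support, snc with the boundary).
[cite: BierstoneGrigorievMilmanWlodarczyk2011, Def. 3.1.3] -/
theorem exists_isMarkedResolution_of_dim_le_one (hreg : Scheme.IsRegular X) (hdim : topologicalKrullDim X ≤ 1)
    {I : X.IdealSheafData} (hI : I ≠ ⊥) {E : List X.IdealSheafData} (hE : HasSNC E) {m : ℕ} (hm : 1 ≤ m) :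
    ∃ M' : MarkedIdeal X, IsMarkedResolution (⟨I, E, m⟩ : MarkedIdeal X) (𝟙 X) M' := by
  haveI : IsNoetherian X := {}
  -- the locus of order `≥ m` of an ideal
  let S : X.IdealSheafData → Set X := fun J => {y | (m : ℕ∞) ≤ idealOrder J y}
  have hS_sub : ∀ J : X.IdealSheafData, S J ⊆ (J.support : Set X) := by
    intro J y hy
    have h1 : (1 : ℕ∞) ≤ idealOrder J y := le_trans (by exact_mod_cast hm) hy
    exact (one_le_idealOrder_iff J y).mp h1
  have hsupp_ne : ∀ J : X.IdealSheafData, J ≠ ⊥ → (J.support : Set X) ≠ Set.univ := by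
    intro J hJ h
    apply hJ
    rw [← support_eq_top_iff]
    exact Closeds.ext (by simpa using h)
  have hfin : ∀ J : X.IdealSheafData, J ≠ ⊥ → (S J).Finite ∧ ∀ y ∈ S J, IsClosed ({y} : Set X) := by
    intro J hJ
    obtain ⟨hf, hcl⟩ := Set.finite_and_isClosed_singleton_of_dim_le_one hdim J.support.isClosed (hsupp_ne J hJ)
    exact ⟨hf.subset (hS_sub J), fun y hy => hcl y (hS_sub J hy)⟩
  have hdvr : ∀ J : X.IdealSheafData, J ≠ ⊥ → ∀ y ∈ S J, IsDiscreteValuationRing (X.presheaf.stalk y) := by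
    intro J hJ y hy
    have hyη : y ≠ genericPoint X := by
      intro hyη
      apply hsupp_ne J hJ
      have hmem : genericPoint X ∈ (J.support : Set X) := hyη ▸ hS_sub J hy
      exact Set.eq_univ_of_univ_subset
        (((genericPoint_spec X).mem_closed_set_iff J.support.isClosed).mp hmem)
    exact isDiscreteValuationRing_stalk_of_dim_le_one
      (fun z => by haveI := hreg z; exact isIntegrallyClosed_of_isRegularLocalRing _) hdim hyη
  -- induction on the number of points of order `≥ m`, over marked ideals of multiplicity `m` with snc boundary
  suffices key : ∀ (n : ℕ) (M : MarkedIdeal X), M.mult = m → M.ideal ≠ ⊥ → HasSNC M.boundary →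
      (S M.ideal).ncard ≤ n → ∃ M' : MarkedIdeal X, IsMultipleBlowup M (𝟙 X) M' ∧ M'.support = ∅ by
    obtain ⟨M', hMB, hsupp⟩ := key _ ⟨I, E, m⟩ rfl hI hE le_rfl
    exact ⟨M', hMB, hsupp⟩
  -- the support of a marked ideal of multiplicity `m` is `S` of its ideal
  have hsuppS : ∀ M : MarkedIdeal X, M.mult = m → M.support = S M.ideal := by
    intro M hM
    ext y
    change (M.mult : ℕ∞) ≤ idealOrder M.ideal y ↔ (m : ℕ∞) ≤ idealOrder M.ideal y
    rw [hM]
  intro n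
  induction n with
  | zero =>
    intro M hMm hMI hME hcard
    have hempty : S M.ideal = ∅ := (Set.ncard_eq_zero (hfin M.ideal hMI).1).mp (Nat.le_zero.mp hcard)
    exact ⟨M, IsMultipleBlowup.refl M, by rw [hsuppS M hMm, hempty]⟩
  | succ n ih =>
    intro M hMm hMI hME hcard
    by_cases hempty : S M.ideal = ∅
    · exact ⟨M, IsMultipleBlowup.refl M, by rw [hsuppS M hMm, hempty]⟩
    obtain ⟨x, hxS⟩ := Set.nonempty_iff_ne_empty.mpr hempty
    have hx : IsClosed ({x} : Set X) := (hfin M.ideal hMI).2 x hxS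
    haveI : IsDiscreteValuationRing (X.presheaf.stalk x) := hdvr M.ideal hMI x hxS
    obtain ⟨v, hv, -⟩ := exists_stalkIdeal_eq_pow_of_dvr M.ideal (stalkIdeal_ne_bot_of_ne_bot hMI x)
    obtain ⟨M₁, hseq, hE₁, hmult₁, hord, hy, hle⟩ := marked_reduce_at_point hx hm v M hMm hv hME
    have hM₁I : M₁.ideal ≠ ⊥ := by
      intro h
      apply hMI
      rw [h] at hle
      exact le_bot_iff.mp hle
    -- the points of order `≥ m` of `M₁.ideal` are those of `M.ideal` other than `x`
    have hS' : S M₁.ideal ⊆ S M.ideal \ {x} := by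
      intro y hy'
      have hyx : y ≠ x := by
        rintro rfl
        exact absurd hy' (not_le.mpr hord)
      refine ⟨?_, hyx⟩
      change (m : ℕ∞) ≤ idealOrder M.ideal y
      rw [← idealOrder_congr_stalkIdeal (hy y hyx)]
      exact hy'
    have hcard' : (S M₁.ideal).ncard ≤ n := by
      have h1 : (S M₁.ideal).ncard ≤ (S M.ideal \ {x}).ncard := Set.ncard_le_ncard hS' ((hfin M.ideal hMI).1.sdiff)
      have h2 : (S M.ideal \ {x}).ncard = (S M.ideal).ncard - 1 := Set.ncard_sdiff_singleton_of_mem hxS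
      omega
    obtain ⟨M', hMB', hsupp'⟩ := ih M₁ hmult₁ hM₁I hE₁ hcard'
    refine ⟨M', ?_, hsupp'⟩
    have h := hseq.trans hMB'
    rwa [Category.comp_id] at h

end Curve

/-! ## §4 In the binders of the host item -/

/-- **THE `d ≤ 1` SLICE OF THE HOST ITEM'S LITERAL CONCLUSION.** For any field `k` and `s : X → Spec k` locally of finite type and
quasi-compact with `X` integral, regular, of `topologicalKrullDim ≤ 1`, every marked ideal `(I, E, m)` with `I ≠ ⊥`, `E` snc and `m ≥ 1`
has a marked resolution in the sense of BGMW Def. 3.1.3 (`IsMarkedResolution`: a multiple blow-up with regular centres inside the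
supports, snc with the boundaries, ending with empty support) — here with `X′ = X`, `Φ = 𝟙 X`. The binders of MarkedTransfer
`HypersurfaceOrderReductionDimLeThree` (stmt-16156) with `3 ↦ 1`; its `CharP`/`PerfectField`/`IsSeparated`/`IsEffectiveCartier`
binders are not needed. A partial result on the host item itself; nothing about `d = 2, 3`.
[cite: BierstoneGrigorievMilmanWlodarczyk2011, Def. 3.1.3] -/
theorem hypersurfaceOrderReduction_of_dim_le_one {k : Type u} [Field k] (X : Scheme.{u}) (s : X ⟶ Spec (.of k))
    [LocallyOfFiniteType s] [QuasiCompact s] [IsIntegral X] (hreg : Scheme.IsRegular X) (hdim : topologicalKrullDim X ≤ 1)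
    (I : X.IdealSheafData) (hI : I ≠ ⊥) (E : List X.IdealSheafData) (hE : HasSNC E) (m : ℕ) (hm : 1 ≤ m) :
    ∃ (X' : Scheme.{u}) (Φ : X' ⟶ X) (M' : MarkedIdeal X'), IsMarkedResolution (⟨I, E, m⟩ : MarkedIdeal X) Φ M' := by
  haveI : IsLocallyNoetherian X := LocallyOfFiniteType.isLocallyNoetherian s
  haveI : CompactSpace X := QuasiCompact.compactSpace_of_compactSpace s
  obtain ⟨M', hM'⟩ := exists_isMarkedResolution_of_dim_le_one hreg hdim hI hE hm
  exact ⟨X, 𝟙 X, M', hM'⟩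

end CampaignW46

end Summit.ResolutionOfSingularities.ResolutionOfSingularities.Theorems

end
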